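import Mathlib
import Literature.NumberTheory.Transcendental.KZCalculusProofs
import Literature.NumberTheory.Transcendental.KZLogCalculusProofs
import Literature.NumberTheory.Transcendental.KZSemiCanonicalReductionProofs
import Literature.NumberTheory.Transcendental.SemialgebraicLineDeriv
import Literature.NumberTheory.Transcendental.KZBetaChains
import Summits.KontsevichZagierPeriods.KontsevichZagierPeriods.Theorems.HyperbolicBlochOffTetraSectorKernelStubVPiece

/-!
# `OffTetraSectorKernel`, line `odd-hyperbolic-ladder`: flattening a standard triangle (stub `stub_stdFlatten`)

Stub `stub_stdFlatten` of the crux `OffTetraSectorKernel` (stmt-KontsevichZagierPeriods-10557, route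
HyperbolicBloch). In the upper half-plane (coordinates `p 0 = x`, `p 1 = t`, area element `t⁻²`)
the standard doubly-ideal triangle is `Std γ = {γ < x < 1, t > 0, x² + t² > 1}`, of area `arccos γ`.
For real-algebraic `γ ∈ (−1, 1)` the representation `[Std γ, t⁻²]` is equivalent, by the moves of
the Kontsevich–Zagier calculus, to the one-dimensional representation `[(γ, 1), (1 − x²)^{-1/2}]`:

* rule (2): the height inversion `Φ(x, t) = (x, 1/t)` is an involution of `{t ≠ 0}`, a
  `ℚ`-semialgebraic injective map on `Std γ ⊆ {t > 0}` with derivative `diag(1, −1/t²)`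
  (`|det| = t⁻²`), and it maps `Std γ` onto the open region
  `U = {γ < x < 1, 0 < s < (1 − x²)^{-1/2}}` under the graph of `(1 − x²)^{-1/2}`
  (`x² + t² > 1 ⇔ 1/t < (1 − x²)^{-1/2}` for `|x| < 1`); with integrand `1` on `U` the Jacobian
  identity `t⁻² = 1 · |det DΦ|` makes `[Std γ, t⁻²] − [U, 1]` ONE change-of-variables move, and
  `[U, 1]` exists (semialgebraic image by Tarski–Seidenberg, integrability by the
  change-of-variables criterion);
* rule (1a): `U` differs from the closed-fibred band `{γ < x < 1, 0 ≤ s ≤ (1 − x²)^{-1/2}}` by two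
  graphs of semialgebraic functions, which are Lebesgue-null (`KZ.volume_graph_eq_zero`);
* rule (3): the band with integrand `1` is ONE Newton–Leibniz move (primitive `s`) away from
  `[(γ, 1), (1 − x²)^{-1/2}]` (`KZ.exists_underGraph`).
The one-dimensional representation exists: `(γ, 1)` is `ℚ`-semialgebraic for algebraic `γ`,
`(1 − x²)^{-1/2}` is a `ℚ`-semialgebraic function (square root and inverse of a polynomial) and it
is integrable on `(γ, 1)` (the V-piece computation `vPiece_integrableOn_Ioo`, transported from `ℝ`
to `ℝ¹` by `KZ.integrableOn_setOf_apply_mem_iff`).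

References: M. Kontsevich, D. Zagier, *Periods* (2001), §1.2 rules (1)–(3); J. Bochnak, M. Coste,
M.-F. Roy, *Real Algebraic Geometry* (1998), §2.2.
-/

noncomputable section

open Set MeasureTheory MvPolynomial
open Literature.NumberTheory.Transcendental Literature.ModelTheory.ExponentialFields

namespace Summit.KontsevichZagierPeriods.HyperbolicBloch.OffTetraSectorKernel

/-! ### The flattening map `Φ(x, t) = (x, 1/t)` -/

/-- The coordinates of the flattening map `Φ(x, t) = (x, 1/t)`. [folklore] -/
theorem flatten_apply (Φ : (Fin 2 → ℝ) → (Fin 2 → ℝ)) (hΦ : ∀ p, Φ p = ![p 0, 1 / p 1])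
    (p : Fin 2 → ℝ) : Φ p 0 = p 0 ∧ Φ p 1 = 1 / p 1 := by
  rw [hΦ]
  exact ⟨rfl, rfl⟩

/-- The flattening map is an involution of `ℝ²` (with Lean's convention `1 / 0 = 0`):
`Φ (Φ p) = p`. [folklore] -/
theorem flatten_flatten (Φ : (Fin 2 → ℝ) → (Fin 2 → ℝ)) (hΦ : ∀ p, Φ p = ![p 0, 1 / p 1])
    (p : Fin 2 → ℝ) : Φ (Φ p) = p := by
  obtain ⟨g0, g1⟩ := flatten_apply Φ hΦ (Φ p)
  obtain ⟨h0, h1⟩ := flatten_apply Φ hΦ p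
  rw [h0] at g0
  rw [h1, one_div_one_div] at g1
  funext i
  fin_cases i
  exacts [g0, g1]

/-- The flattening map is injective (an involution). [folklore] -/
theorem flatten_injective (Φ : (Fin 2 → ℝ) → (Fin 2 → ℝ)) (hΦ : ∀ p, Φ p = ![p 0, 1 / p 1]) :
    Function.Injective Φ :=
  Function.LeftInverse.injective (g := Φ) (flatten_flatten Φ hΦ)

/-- The flattening map is a `ℚ`-semialgebraic map on every `ℚ`-semialgebraic `σ ⊆ {t > 0}`: its
coordinates are the polynomial `X₀` and the quotient `1 / X₁` whose denominator does not vanish on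
`σ`. [cite: BochnakCosteRoy1998, §2.2] -/
theorem flatten_isSemialgebraicMapOn (Φ : (Fin 2 → ℝ) → (Fin 2 → ℝ))
    (hΦ : ∀ p, Φ p = ![p 0, 1 / p 1]) {σ : Set (Fin 2 → ℝ)} (hσ : IsSemialgebraic ℚ σ)
    (hpos : σ ⊆ {p | 0 < p 1}) : IsSemialgebraicMapOn ℚ σ Φ := by
  have hq0 : ∀ p ∈ σ, aeval p (X 1 : MvPolynomial (Fin 2) ℚ) ≠ 0 := fun p hp => by
    have h2 : (0 : ℝ) < p 1 := hpos hp
    simpa using h2.ne'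
  refine IsSemialgebraicMapOn.of_forall hσ fun j => ?_
  fin_cases j
  · exact (isSemialgebraicFunOn_aeval hσ (X 0)).congr fun p _ => by
      simp [(flatten_apply Φ hΦ p).1]
  · exact (isSemialgebraicFunOn_aeval_div_aeval hσ 1 (X 1) hq0).congr fun p _ => by
      simp [(flatten_apply Φ hΦ p).2]

/-- **The image of the standard triangle under the flattening map** is the open region under the
graph of `(1 − x²)^{-1/2}` over `(γ, 1)`: for `|x| < 1` and `t > 0`, `x² + t² > 1 ⇔ √(1 − x²) < t ⇔
1/t < 1/√(1 − x²)`; surjectivity by the involution. [folklore] -/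
theorem flatten_image (Φ : (Fin 2 → ℝ) → (Fin 2 → ℝ)) (hΦ : ∀ p, Φ p = ![p 0, 1 / p 1])
    {γ : ℝ} (hγ : -1 ≤ γ) :
    Φ '' {p : Fin 2 → ℝ | γ < p 0 ∧ p 0 < 1 ∧ 0 < p 1 ∧ 1 < (p 0 - 0) ^ 2 + p 1 ^ 2} =
      {q : Fin 2 → ℝ | γ < q 0 ∧ q 0 < 1 ∧ 0 < q 1 ∧ q 1 < 1 / Real.sqrt (1 - q 0 ^ 2)} := by
  have hsq : ∀ x : ℝ, γ < x → x < 1 → 0 < Real.sqrt (1 - x ^ 2) := fun x h1 h2 =>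
    Real.sqrt_pos.2 (by nlinarith [mul_pos (sub_pos.2 h2) (show (0 : ℝ) < 1 + x by linarith)])
  ext q
  constructor
  · rintro ⟨p, ⟨h1, h2, h3, h4⟩, rfl⟩
    obtain ⟨e0, e1⟩ := flatten_apply Φ hΦ p
    simp only [mem_setOf_eq, e0, e1]
    have h5 : Real.sqrt (1 - p 0 ^ 2) < p 1 := by
      have h := vPiece_fibre_iff.1 ⟨h3, h4⟩
      simpa using h
    exact ⟨h1, h2, one_div_pos.2 h3, one_div_lt_one_div_of_lt (hsq _ h1 h2) h5⟩
  · rintro ⟨h1, h2, h3, h4⟩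
    refine ⟨Φ q, ?_, flatten_flatten Φ hΦ q⟩
    obtain ⟨e0, e1⟩ := flatten_apply Φ hΦ q
    simp only [mem_setOf_eq, e0, e1]
    have h5 : Real.sqrt (1 - q 0 ^ 2) < 1 / q 1 := (lt_one_div h3 (hsq _ h1 h2)).1 h4
    have h6 : 0 < 1 / q 1 ∧ 1 < (q 0 - 0) ^ 2 + (1 / q 1) ^ 2 :=
      vPiece_fibre_iff.2 (by simpa using h5)
    exact ⟨h1, h2, h6⟩

/-- **The derivative of the flattening map and its determinant.** At a point with `t ≠ 0`, `Φ` has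
the Fréchet derivative of matrix `diag(1, −1/t²)`, of determinant `−1/t²`. [folklore] -/
theorem flatten_hasFDerivAt_det (Φ : (Fin 2 → ℝ) → (Fin 2 → ℝ))
    (hΦ : ∀ p, Φ p = ![p 0, 1 / p 1]) {p : Fin 2 → ℝ} (hp : p 1 ≠ 0) :
    ∃ L : (Fin 2 → ℝ) →L[ℝ] (Fin 2 → ℝ), HasFDerivAt Φ L p ∧ L.det = -(p 1 ^ 2)⁻¹ := by
  set M : Matrix (Fin 2) (Fin 2) ℝ := !![1, 0; 0, -(p 1 ^ 2)⁻¹] with hM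
  refine ⟨LinearMap.toContinuousLinearMap (Matrix.toLin' M), ?_, ?_⟩
  · -- derivative, componentwise
    have h0 : HasFDerivAt (fun x => Φ x 0)
        ((ContinuousLinearMap.proj 0).comp (LinearMap.toContinuousLinearMap (Matrix.toLin' M))) p := by
      have hf : (fun x => Φ x 0) = fun x : Fin 2 → ℝ => x 0 := by
        funext x
        exact (flatten_apply Φ hΦ x).1
      rw [hf]
      refine (hasFDerivAt_apply (𝕜 := ℝ) (0 : Fin 2) p).congr_fderiv ?_
      ext v
      simp [hM, Matrix.toLin'_apply, dotProduct, Fin.sum_univ_two]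
    have h1 : HasFDerivAt (fun x => Φ x 1)
        ((ContinuousLinearMap.proj 1).comp (LinearMap.toContinuousLinearMap (Matrix.toLin' M))) p := by
      have hf : (fun x => Φ x 1) = (fun y : ℝ => y⁻¹) ∘ fun x : Fin 2 → ℝ => x 1 := by
        funext x
        simp [(flatten_apply Φ hΦ x).2]
      rw [hf]
      refine ((hasDerivAt_inv hp).comp_hasFDerivAt p
        (hasFDerivAt_apply (𝕜 := ℝ) (1 : Fin 2) p)).congr_fderiv ?_
      ext v
      simp [hM, Matrix.toLin'_apply, dotProduct, Fin.sum_univ_two]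
    refine hasFDerivAt_pi'' fun i => ?_
    fin_cases i
    exacts [h0, h1]
  · -- determinant
    rw [LinearMap.det_toContinuousLinearMap, LinearMap.det_toLin', Matrix.det_fin_two]
    simp [hM]

/-- **Flattening move data on `σ ⊆ {t > 0}`**: a derivative `Φ'` within `σ` at every point of `σ`
with `|det Φ' p| = t⁻²`, the hyperbolic area element. [cite: KontsevichZagier2001, §1.2 rule (2)] -/
theorem flatten_moveData (Φ : (Fin 2 → ℝ) → (Fin 2 → ℝ)) (hΦ : ∀ p, Φ p = ![p 0, 1 / p 1])
    {σ : Set (Fin 2 → ℝ)} (hpos : σ ⊆ {p | 0 < p 1}) :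
    ∃ Φ' : (Fin 2 → ℝ) → ((Fin 2 → ℝ) →L[ℝ] (Fin 2 → ℝ)), ∀ x ∈ σ,
      HasFDerivWithinAt Φ (Φ' x) σ x ∧ |(Φ' x).det| = 1 / x 1 ^ 2 := by
  have hex : ∀ x : Fin 2 → ℝ, ∃ L : (Fin 2 → ℝ) →L[ℝ] (Fin 2 → ℝ),
      x 1 ≠ 0 → HasFDerivAt Φ L x ∧ L.det = -(x 1 ^ 2)⁻¹ := by
    intro x
    by_cases hx : x 1 = 0
    · exact ⟨0, fun h => (h hx).elim⟩
    · obtain ⟨L, hL, hdet⟩ := flatten_hasFDerivAt_det Φ hΦ hx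
      exact ⟨L, fun _ => ⟨hL, hdet⟩⟩
  choose Φ' hΦ' using hex
  refine ⟨Φ', fun x hx => ?_⟩
  have hx1 : 0 < x 1 := hpos hx
  obtain ⟨hL, hdet⟩ := hΦ' x hx1.ne'
  refine ⟨hL.hasFDerivWithinAt, ?_⟩
  rw [hdet, abs_neg, abs_of_pos (inv_pos.mpr (pow_pos hx1 2)), one_div]

/-! ### The one-dimensional representation `[(γ, 1), (1 − x²)^{-1/2}]` -/

/-- The interval `(γ, 1) ⊆ ℝ¹` is `ℚ`-semialgebraic for real-algebraic `γ` (real algebraic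
constants are `ℚ`-definable). [cite: KontsevichZagier2001, §1.1] -/
theorem arc_isSemialgebraic {γ : ℝ} (hγ : IsAlgebraic ℚ γ) :
    IsSemialgebraic ℚ {x : Fin 1 → ℝ | x 0 ∈ Ioo γ 1} := by
  have hU : IsSemialgebraic ℚ (univ : Set (Fin 1 → ℝ)) := isSemialgebraic_univ
  have hco : IsSemialgebraicFunOn ℚ (univ : Set (Fin 1 → ℝ)) (fun p => p 0) :=
    isSemialgebraicFunOn_apply_univ 0
  have S1 : IsSemialgebraic ℚ {p : Fin 1 → ℝ | γ < p 0} :=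
    isSemialgebraic_setOf_lt_of_isSemialgebraicFunOn
      (isSemialgebraicFunOn_const_of_isAlgebraic hU hγ) hco
  have S2 : IsSemialgebraic ℚ {p : Fin 1 → ℝ | p 0 < 1} :=
    isSemialgebraic_setOf_lt_of_isSemialgebraicFunOn hco
      (isSemialgebraicFunOn_const_of_isAlgebraic hU isAlgebraic_one)
  convert S1.inter S2 using 1
  ext p
  simp

/-- The integrand `(1 − x²)^{-1/2}` is a `ℚ`-semialgebraic function on `(γ, 1) ⊆ ℝ¹` (inverse of
the square root of a rational polynomial). [cite: BochnakCosteRoy1998, Prop. 2.2.6] -/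
theorem arc_isSemialgebraicFunOn {γ : ℝ} (hγ : IsAlgebraic ℚ γ) :
    IsSemialgebraicFunOn ℚ {x : Fin 1 → ℝ | x 0 ∈ Ioo γ 1}
      (fun x => 1 / Real.sqrt (1 - x 0 ^ 2)) := by
  have hD := arc_isSemialgebraic hγ
  have h1 : IsSemialgebraicFunOn ℚ {x : Fin 1 → ℝ | x 0 ∈ Ioo γ 1} (fun x => 1 - x 0 ^ 2) :=
    (isSemialgebraicFunOn_aeval hD (1 - X 0 ^ 2 : MvPolynomial (Fin 1) ℚ)).congr fun x _ => by
      simp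
  exact h1.fun_sqrt.fun_inv.congr fun x _ => (one_div _).symm

/-- The integrand `(1 − x²)^{-1/2}` is integrable on `(γ, 1) ⊆ ℝ¹` for `−1 ≤ γ ≤ 1` (it is the V-piece
fibre integral `1/√(c − (x − a)²)` with `a = 0`, `c = 1`; its integral is `arccos γ`). [folklore] -/
theorem arc_integrableOn {γ : ℝ} (hγ1 : -1 ≤ γ) (hγ2 : γ ≤ 1) :
    IntegrableOn (fun x : Fin 1 → ℝ => 1 / Real.sqrt (1 - x 0 ^ 2))
      {x : Fin 1 → ℝ | x 0 ∈ Ioo γ 1} := by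
  have hsq : (γ - 0) ^ 2 ≤ 1 := by nlinarith
  have h : IntegrableOn (fun x : ℝ => 1 / Real.sqrt (1 - x ^ 2)) (Ioo γ 1) := by
    simpa using vPiece_integrableOn_Ioo (a := 0) (c := 1) hγ2 hsq (by norm_num) one_pos
  exact (KZ.integrableOn_setOf_apply_mem_iff (g := fun x : ℝ => 1 / Real.sqrt (1 - x ^ 2))).2 h

/-- **The representation `[(γ, 1), (1 − x²)^{-1/2}]` exists** for real-algebraic `γ ∈ [−1, 1]`.
[cite: KontsevichZagier2001, §1.1] -/
theorem arc_exists_rep {γ : ℝ} (hγ : IsAlgebraic ℚ γ) (hγ1 : -1 ≤ γ) (hγ2 : γ ≤ 1) :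
    ∃ A : KZ.IntegralRep 1, A.domain = {x | x 0 ∈ Ioo γ 1} ∧
      A.integrand = fun x => 1 / Real.sqrt (1 - x 0 ^ 2) :=
  ⟨⟨{x | x 0 ∈ Ioo γ 1}, fun x => 1 / Real.sqrt (1 - x 0 ^ 2), arc_isSemialgebraic hγ,
    arc_isSemialgebraicFunOn hγ, arc_integrableOn hγ1 hγ2⟩, rfl, rfl⟩

/-! ### The stub -/

/-- **STUB `stub_stdFlatten`: flattening a standard triangle.** For algebraic `γ ∈ (−1, 1)` the
representation `[Std γ, t⁻²]` is KZ-equivalent to `[(γ, 1), (1 − x²)^{-1/2}]`: the move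
`(x, t) ↦ (x, 1/t)` (rule (2), Jacobian `t⁻²`) carries `Std γ` onto the region under the graph of
`(1 − x²)^{-1/2}` over `(γ, 1)` with integrand `1`, two null graphs are adjusted by rule (1a), and
ONE Newton–Leibniz move (rule (3), primitive `s`; `KZ.exists_underGraph`) integrates the fibre.
Existence of the flat representation is part of the claim.
[cite: KontsevichZagier2001, §1.2 rules (2), (3)] -/
theorem stub_stdFlatten :
    ∀ γ : ℝ, IsAlgebraic ℚ γ → -1 < γ → γ < 1 →
    ∀ (S : KZ.IntegralRep 2), S.domain = {p | γ < p 0 ∧ p 0 < 1 ∧ 0 < p 1 ∧ 1 < (p 0 - 0) ^ 2 + p 1 ^ 2} →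
      EqOn S.integrand (fun p => 1 / p 1 ^ 2) S.domain →
      (∃ A : KZ.IntegralRep 1, A.domain = {x | x 0 ∈ Ioo γ 1} ∧
        A.integrand = fun x => 1 / Real.sqrt (1 - x 0 ^ 2)) ∧
      (∀ A : KZ.IntegralRep 1, A.domain = {x | x 0 ∈ Ioo γ 1} →
        (A.integrand = fun x => 1 / Real.sqrt (1 - x 0 ^ 2)) → KZ.of S - KZ.of A ∈ KZ.relations) := by
  intro γ hγ hγ1 hγ2 S hS hSi
  refine ⟨arc_exists_rep hγ hγ1.le hγ2.le, fun A hA hAi => ?_⟩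
  -- the move `Φ(x, t) = (x, 1/t)`
  set Φ : (Fin 2 → ℝ) → (Fin 2 → ℝ) := fun p => ![p 0, 1 / p 1] with hΦdef
  have hΦ : ∀ p, Φ p = ![p 0, 1 / p 1] := fun _ => rfl
  -- `Std γ ⊆ {t > 0}`
  have hpos : S.domain ⊆ {p | 0 < p 1} := by
    rw [hS]
    exact fun p hp => hp.2.2.1
  -- the image is the open region `U` under the graph
  have himage : Φ '' S.domain =
      {q : Fin 2 → ℝ | γ < q 0 ∧ q 0 < 1 ∧ 0 < q 1 ∧ q 1 < 1 / Real.sqrt (1 - q 0 ^ 2)} := by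
    rw [hS]
    exact flatten_image Φ hΦ hγ1.le
  -- the four data of the move
  have hΦsa : IsSemialgebraicMapOn ℚ S.domain Φ :=
    flatten_isSemialgebraicMapOn Φ hΦ S.isSemialgebraic_domain hpos
  have hinj : InjOn Φ S.domain := (flatten_injective Φ hΦ).injOn
  obtain ⟨Φ', hΦ'⟩ := flatten_moveData Φ hΦ hpos
  have hmeas : MeasurableSet S.domain := KZ.IntegralRep.measurableSet_domain_holds S
  -- EXISTENCE of `[U, 1]`: semialgebraic image, constant integrand, change of variables
  have hT : IsSemialgebraic ℚ (Φ '' S.domain) :=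
    IsSemialgebraicMapOn.isSemialgebraic_image_holds hΦsa subset_rfl S.isSemialgebraic_domain
  have hF : IsSemialgebraicFunOn ℚ (Φ '' S.domain) (fun _ : Fin 2 → ℝ => (1 : ℝ)) := by
    simpa using isSemialgebraicFunOn_ratCast hT 1
  have hI : IntegrableOn (fun _ : Fin 2 → ℝ => (1 : ℝ)) (Φ '' S.domain) := by
    rw [integrableOn_image_iff_integrableOn_abs_det_fderiv_smul volume hmeas
      (fun x hx => (hΦ' x hx).1) hinj]
    refine S.integrableOn.congr_fun (fun x hx => ?_) hmeas
    calc S.integrand x = 1 / x 1 ^ 2 := hSi hx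
      _ = |(Φ' x).det| := (hΦ' x hx).2.symm
      _ = |(Φ' x).det| • (1 : ℝ) := by rw [smul_eq_mul, mul_one]
  obtain ⟨R, hRd, hRi⟩ : ∃ R : KZ.IntegralRep 2, R.domain = Φ '' S.domain ∧
      R.integrand = fun _ => 1 :=
    ⟨⟨Φ '' S.domain, fun _ => 1, hT, hF, hI⟩, rfl, rfl⟩
  -- rule (2): `[S] − [R]` is one change-of-variables move
  have hSR : KZ.of S - KZ.of R ∈ KZ.relations := by
    refine KZ.changeOfVariablesRel_subset_relations
      ⟨2, S, R, Φ, Φ', hΦsa, fun x hx => (hΦ' x hx).1, hinj, hRd, fun x hx => ?_, rfl⟩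
    rw [hRi, (hΦ' x hx).2, hSi hx]
    simp only [one_mul]
  -- rule (3): the band under the graph of `A` with integrand `1`
  have h0 : ∀ x ∈ A.domain, 0 ≤ A.integrand x := fun x _ => by
    rw [hAi]
    positivity
  obtain ⟨G, hGd, hGi, hGA⟩ := KZ.exists_underGraph A h0
  -- rule (1a): `U` and the band differ by two null graphs
  have hzero : IsSemialgebraicFunOn ℚ A.domain (fun _ => (0 : ℝ)) := by
    simpa using isSemialgebraicFunOn_ratCast A.isSemialgebraic_domain 0
  have hRG : KZ.of R - KZ.of G ∈ KZ.relations := by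
    refine KZ.of_sub_of_mem_relations_of_null R G ?_ ?_ (fun x _ => by rw [hRi, hGi])
    · -- `U ⊆ band`, so the difference is empty
      have hsub : Φ '' S.domain ⊆ G.domain := by
        intro q hq
        rw [himage] at hq
        obtain ⟨h1, h2, h3, h4⟩ := hq
        rw [hGd, KZlog.mem_band, hA, hAi]
        exact ⟨⟨h1, h2⟩, h3.le, h4.le⟩
      rw [hRd, Set.sdiff_eq_empty.mpr hsub, measure_empty]
    · -- `band \ U` lies in the graphs `s = 0` and `s = (1 − x²)^{-1/2}` over `(γ, 1)`
      have hnull : volume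
          ({z : Fin 2 → ℝ | Fin.init z ∈ A.domain ∧ z (Fin.last 1) = (fun _ => (0 : ℝ)) (Fin.init z)} ∪
            {z : Fin 2 → ℝ | Fin.init z ∈ A.domain ∧ z (Fin.last 1) = A.integrand (Fin.init z)}) = 0 :=
        measure_union_null (KZ.volume_graph_eq_zero hzero)
          (KZ.volume_graph_eq_zero A.isSemialgebraicFunOn_integrand)
      rw [hRd]
      refine measure_mono_null (fun z hz => ?_) hnull
      have hzG : z ∈ G.domain := hz.1
      have hzU : z ∉ Φ '' S.domain := hz.2
      rw [hGd, KZlog.mem_band] at hzG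
      obtain ⟨hzD, hz0, hzf⟩ := hzG
      rcases hz0.lt_or_eq with hlt0 | heq0
      · rcases hzf.lt_or_eq with hltf | heqf
        · exfalso
          refine hzU ?_
          rw [himage]
          rw [hA] at hzD
          rw [hAi] at hltf
          exact ⟨hzD.1, hzD.2, hlt0, hltf⟩
        · exact Or.inr ⟨hzD, heqf⟩
      · exact Or.inl ⟨hzD, heq0.symm⟩
  -- assemble: `[S] − [A] = ([S] − [R]) + ([R] − [G]) + ([G] − [A])`
  have hsum : KZ.of S - KZ.of A =
      (KZ.of S - KZ.of R) + (KZ.of R - KZ.of G) + (KZ.of G - KZ.of A) := by abel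
  rw [hsum]
  exact KZ.relations.add_mem (KZ.relations.add_mem hSR hRG)
    (KZ.newtonLeibnizRel_subset_relations hGA)

end Summit.KontsevichZagierPeriods.HyperbolicBloch.OffTetraSectorKernel

end
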